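import Summits.BirchSwinnertonDyer.Rank1Residual.AdditivePotMult.PotMultChiBranchPrime
import Summits.BirchSwinnertonDyer.Rank1Residual.Additive.GordChiBranchWuthrichComponent
import Summits.BirchSwinnertonDyer.Rank1Residual.Additive.GordChiBranchKatoComponent
import Literature.NumberTheory.EllipticCurves.Wuthrich2014.ReducibleDivisibilityCyclotomicPrimeComponentOfHalf
import Literature.NumberTheory.EllipticCurves.Kato2004.BigImageDivisibilityCyclotomicPrimeComponentOfHalf
import HarnessLib

/-!
# [B∘C]@0 for EVERY ADDITIVE `(E, p)`, `p` odd: the four typed `χ_p`-branch inputs from the TWO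
# general-`p` semistable component readings alone (cells (M) ∪ (G) of X3/X4; joint statement of
# additive-p1's `PotMultChiBranchPrime` and additive-p2's `GordChiBranch{Kato,Wuthrich}Component`)
# (cell `b2b-bsdres`, seat additive-p1, gen 9)

HONEST FRAMING (cell `b2b-bsdres`, run/shared/lean/b2b/bsd-rank1-residual/, verbatim in every
file): the goal of the cell is to DELETE the COMBINATION-SHAPED residual classes of the
Birch–Swinnerton-Dyer formula for ALL analytic-rank `≤ 1` elliptic curves over `ℚ` — "full BSD
formula for every rank `≤ 1` curve in class `C`" assembled STRICTLY from published theorems — so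
that the rank-`≤ 1` remainder becomes exactly the CONSTRUCTION-SHAPED classes, which are TYPED
(missing-input `Prop`s), NOT attempted. This is not "finishing BSD". The additive sub-cell (seats
additive-p1…p4) is a RESEARCH ROUTE on the construction-shaped classes X3/X4; no claim beyond the
stated classes; the labels of X3/X4 are UNCHANGED by this file; nothing is booked.

Theorems only (four two-line case splits; no definition, no named fact). additive-p4's typed inputs
`ChiBranchLeadingTerm[Odd][BigImage]At W p` ([B∘C] at `T = 0`; the ONLY non-published input of the
rank-`0` upper half on X3/X4 at an odd `p` since additive-p4 gen 2) are theorems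
* for `ord_p j(W) ≥ 0` (⊇ the potentially GOOD cells) by additive-p2's
  `chiBranchLeadingTerm[Odd][BigImage]At_of_{wuthrich,kato}Component` (gen 12), from the good-ordinary
  component readings A125 / A124 — which are themselves derived in the kernel from the general
  semistable component readings (`Wuthrich2014.charIdeal_dvd_padicLFunctionBranch_component_of_half`,
  `Kato2004.charIdeal_dvd_padicLFunctionBranch_component_of_surjective_of_half`; gen 9, debt-free);
* for `ord_p j(W) < 0` and `W` additive at `p` (= `PotMult W p`, the potentially MULTIPLICATIVE cells)
  by this seat's `PotMult.chiBranchLeadingTerm[Odd][BigImage]At_of_halfFact` (gen 9).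
Hence, for EVERY `W` ADDITIVE at an odd `p`: **all four typed inputs follow from the two general-`p`
reading-facts `Wuthrich2014.thm16_halfEigenCharIdeal_dvd_cyclotomicPrime` (p235418) /
`Wuthrich2014.kato_halfEigenCharIdeal_dvd_cyclotomicPrime_of_surjective` (p235488) ALONE**
(`Addv.chiBranchLeadingTermAt_of_halfFact`, `…OddAt…`, `…BigImageAt…`, `…OddBigImageAt…`). Labels
UNCHANGED; the LOWER half stays printed nowhere; nothing booked.

References: Wuthrich 2014 [Wuthrich2014] §3 p. 390, Thm. 16, Cor. 19; Kato 2004 [Kato2004Asterisque]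
Thm. 17.4.
-/

noncomputable section

open scoped Classical

namespace Summit.BirchSwinnertonDyer.Rank1Residual.AdditivePotMult

open WeierstrassCurve Literature.NumberTheory.EllipticCurves
  Literature.NumberTheory.EllipticCurves.Rank1Residual Additive

variable {W : WeierstrassCurve ℚ} [W.IsElliptic] {p : ℕ} [hp : Fact p.Prime]

/-- **`ChiBranchLeadingTermAt W p` for every ADDITIVE `(W, p)`** from the general semistable
component reading alone (`ord_p j ≥ 0`: additive-p2's Gord theorem with A125 derived from the
general fact; `ord_p j < 0`: the pot-mult theorem). [cite: Wuthrich2014, Thm. 16 (p. 397) and §3 (p. 390)] -/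
theorem Addv.chiBranchLeadingTermAt_of_halfFact
    (hW16 : Wuthrich2014.thm16_halfEigenCharIdeal_dvd_cyclotomicPrime) (hadd : Addv W p) :
    ChiBranchLeadingTermAt W p := by
  by_cases hj : 0 ≤ padicValRat p W.j
  · exact chiBranchLeadingTermAt_of_wuthrichComponent W p
      (Wuthrich2014.charIdeal_dvd_padicLFunctionBranch_component_of_half hW16) hj
  · exact PotMult.chiBranchLeadingTermAt_of_halfFact hW16 ⟨hadd, lt_of_not_ge hj⟩

/-- **`ChiBranchLeadingTermOddAt W p` for every ADDITIVE `(W, p)`** from the general semistable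
component reading alone. [cite: Wuthrich2014, Thm. 16 (p. 397) and §3 (p. 390)] -/
theorem Addv.chiBranchLeadingTermOddAt_of_halfFact
    (hW16 : Wuthrich2014.thm16_halfEigenCharIdeal_dvd_cyclotomicPrime) (hadd : Addv W p) :
    ChiBranchLeadingTermOddAt W p := by
  by_cases hj : 0 ≤ padicValRat p W.j
  · exact chiBranchLeadingTermOddAt_of_wuthrichComponent W p
      (Wuthrich2014.charIdeal_dvd_padicLFunctionBranch_component_of_half hW16) hj
  · exact PotMult.chiBranchLeadingTermOddAt_of_halfFact hW16 ⟨hadd, lt_of_not_ge hj⟩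

/-- **`ChiBranchLeadingTermBigImageAt W p` for every ADDITIVE `(W, p)`** from the general semistable
big-image component reading alone. [cite: Kato2004Asterisque, Thm. 17.4 (3) (p. 273)]
[cite: Wuthrich2014, Cor. 19 (p. 398)] -/
theorem Addv.chiBranchLeadingTermBigImageAt_of_halfFact
    (hKato : Wuthrich2014.kato_halfEigenCharIdeal_dvd_cyclotomicPrime_of_surjective)
    (hadd : Addv W p) : ChiBranchLeadingTermBigImageAt W p := by
  by_cases hj : 0 ≤ padicValRat p W.j
  · exact chiBranchLeadingTermBigImageAt_of_katoComponent W p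
      (Kato2004.charIdeal_dvd_padicLFunctionBranch_component_of_surjective_of_half hKato) hj
  · exact PotMult.chiBranchLeadingTermBigImageAt_of_halfFact hKato ⟨hadd, lt_of_not_ge hj⟩

/-- **`ChiBranchLeadingTermOddBigImageAt W p` for every ADDITIVE `(W, p)`** from the general
semistable big-image component reading alone. [cite: Kato2004Asterisque, Thm. 17.4 (3) (p. 273)]
[cite: Wuthrich2014, Cor. 19 (p. 398)] -/
theorem Addv.chiBranchLeadingTermOddBigImageAt_of_halfFact
    (hKato : Wuthrich2014.kato_halfEigenCharIdeal_dvd_cyclotomicPrime_of_surjective)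
    (hadd : Addv W p) : ChiBranchLeadingTermOddBigImageAt W p := by
  by_cases hj : 0 ≤ padicValRat p W.j
  · exact chiBranchLeadingTermOddBigImageAt_of_katoComponent W p
      (Kato2004.charIdeal_dvd_padicLFunctionBranch_component_of_surjective_of_half hKato) hj
  · exact PotMult.chiBranchLeadingTermOddBigImageAt_of_halfFact hKato ⟨hadd, lt_of_not_ge hj⟩

end Summit.BirchSwinnertonDyer.Rank1Residual.AdditivePotMult

end
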